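import Summits.ValiantsHypothesis.ValiantsHypothesis.Theorems.KPlusLogSqLawTropicalBRegisterPairGadget

/-!
# Route «KPlusLogSqLaw», crux `TropicalB` (stmt-ValiantsHypothesis-19771) — THE REGISTER-PAIR LAW, FIVE-POINT FORM:
# over two same-side registers read by one gadget, already the five hole states (0,2), (1,0), (1,1), (2,0), (2,1) cannot all be dominant

HONEST FRAMING.  Helper toward the registered stubs `stub_tropThin` / `stub_tropFat` of `Cruxes/TropicalB/Lines/birth.lean` (crux
`Summit.ValiantsHypothesis.ValiantsHypothesis.Theses.KPlusLogSqLaw.TropicalB`, item stmt-ValiantsHypothesis-19771, route KPlusLogSqLaw;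
cell `pub-symmetroid`, seat val-sym-trop-p4 g11, 2026-08-27; `--supports … --as helper`).  A STRUCTURE (no-go) theorem about unique optima of
an ARBITRARY design, sharpening `RegisterPair.registerPair_law` (…TropicalBRegisterPair); nothing here bounds `TropicalB`, and nothing bears on
`WeakLifting`, DoorA26 / DoorA34, `MatrixDescartes` (stmt-ValiantsHypothesis-18050) or VP ≠ VNP.

THE LAW (`registerPair_five`).  Setting of the register-pair law: gadget columns `G` of one class `l₀`, interior rows `N`, two same-side registers
with exposed rows `rI a`, `rJ b` (`a, b : Fin 3`), nine PRESENT hole-combination terms `u a b` with gadget rows `N ∪ {rI a, rJ b}`, off-gadget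
columns depending on `a` alone or `b` alone, and slopes increasing in `a` and in `b`.  If the FIVE terms `u 0 2`, `u 1 0`, `u 1 1`, `u 2 0`, `u 2 1`
are unique optima (at arbitrary integer slopes), then `False`.  The four remaining hole states need not be dominant: they enter only as PRESENT
competitors (through hybrids carrying exchanged gadget matchings, `hybrid`), which is all the parallelogram law asks of its outer pair.  By the
`a ↔ b` symmetry the mirror five-set `(2,0), (0,1), (1,1), (0,2), (1,2)` is excluded too, so of the nine «3 × 3 minus one state» patterns only the
three missing an ANTI-DIAGONAL state `(0,2)`, `(1,1)`, `(2,0)` can be all-dominant — and those three ARE realisable (located, seat val-sym-trop-p4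
g11: exact LP oracle on an explicit `(6,3)` design, and random gadgets with up to two interior rows, 2026-08-27).  Proof = the proof of the
register-pair law with dominance used only where needed: strict supermodularity `VG a b' + VG a' b < w M + w M'` for ALL gadget matchings `M`,
`M'` over the outer hole states of a minor whose INNER states are dominant (`parallelogram` with hybrid outer terms), gadget minimality of the
inner states, basis exchange (…TropicalBBasisExchange) and the four minors `{0,1}×{0,2}`, `{0,1}×{1,2}`, `{0,2}×{0,2}`, `{0,2}×{1,2}` plus
`{1,2}×{0,1}`, whose inner states are exactly the five.
[folklore: valuated-matroid exchange (Murota 2003 §9) + hull convexity; the packaging is the cell's]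
-/

set_option linter.dupNamespace false
set_option autoImplicit false

namespace Summit.ValiantsHypothesis.ValiantsHypothesis.Theorems.KPlusLogSqLaw

namespace RegisterPair

open Summit.ValiantsHypothesis.ValiantsHypothesis.Theorems.MatrixDescartes.Negative
open Summit.ValiantsHypothesis.ValiantsHypothesis.Theorems.LacunarySymmetroidMatrixDescartes
open Summit.ValiantsHypothesis.ValiantsHypothesis.Theorems.LacunarySymmetroidMatrixDescartes.TropicalCensus
open Summit.ValiantsHypothesis.ValiantsHypothesis.Theorems.KPlusLogSqLaw.MatchingExchange
open Literature.Computability.MetaComplexity.PBij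
open scoped BigOperators
open Finset

variable {m K : ℕ}

/-- **HYBRID TERMS.**  A present term `p` using class `l₀` on the gadget columns `G`, and any matching `Y` of `G` onto the rows `p(G)` through
present class-`l₀` cells, give a PRESENT term with the slope of `p`, the off-gadget cells of `p` and the gadget cells of `Y`. [folklore] -/
theorem hybrid (d : Fin K → ℕ) (v ε : Fin m → Fin m → Fin K → ℤ) {p : Equiv.Perm (Fin m) × (Fin m → Fin K)}
    (hp : termSign ε p ≠ 0) (G : Finset (Fin m)) (l₀ : Fin K) (hcls : ∀ g ∈ G, p.2 g = l₀) {Y : Finset (Fin m × Fin m)}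
    (hY : IsPMatching Y) (hrng : rng Y = G) (hdom : dom Y = G.image p.1) (hpres : ∀ e ∈ Y, ε e.1 e.2 l₀ ≠ 0) :
    ∃ q : Equiv.Perm (Fin m) × (Fin m → Fin K), termSign ε q ≠ 0 ∧ slope d q = slope d p ∧
      (∑ i, v (q.1 i) i (q.2 i)) + ∑ g ∈ G, v (p.1 g) g l₀ = (∑ i, v (p.1 i) i (p.2 i)) + ∑ e ∈ Y, v e.1 e.2 l₀ := by
  classical
  have huniq : ∀ c, c ∈ G → ∃! e, e ∈ Y ∧ e.2 = c := by
    intro c hc; obtain ⟨a, ha⟩ := mem_rng.1 (hrng.symm ▸ hc)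
    exact ⟨(a, c), ⟨ha, rfl⟩, fun e he => hY e he.1 (a, c) ha (Or.inr he.2)⟩
  let σ' : Fin m → Fin m := fun c => if hc : c ∈ G then (Y.choose (fun e => e.2 = c) (huniq c hc)).1 else p.1 c
  have hσ'G : ∀ c, c ∈ G → (σ' c, c) ∈ Y := by
    intro c hc
    have hspec := Finset.choose_spec (fun e => e.2 = c) Y (huniq c hc)
    have h1 : σ' c = (Y.choose (fun e => e.2 = c) (huniq c hc)).1 := by simp only [σ', dif_pos hc]
    rw [h1]
    have h2 : ((Y.choose (fun e => e.2 = c) (huniq c hc)).1, c) = Y.choose (fun e => e.2 = c) (huniq c hc) :=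
      Prod.ext rfl hspec.2.symm
    rw [h2]; exact hspec.1
  have hσ'nG : ∀ c, c ∉ G → σ' c = p.1 c := fun c hc => by simp only [σ', dif_neg hc]
  have hσ'dom : ∀ c, c ∈ G → σ' c ∈ G.image p.1 := fun c hc => hdom ▸ mem_dom.2 ⟨c, hσ'G c hc⟩
  have hinj : Function.Injective σ' := by
    intro c c' h
    by_cases hc : c ∈ G <;> by_cases hc' : c' ∈ G
    · have e1 := hσ'G c hc
      have e2 := hσ'G c' hc'
      rw [h] at e1
      exact (Prod.mk.inj (hY _ e1 _ e2 (Or.inl rfl))).2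
    · obtain ⟨g, hg, hgc⟩ := Finset.mem_image.1 (hσ'dom c hc)
      rw [h, hσ'nG c' hc'] at hgc; exact absurd (p.1.injective hgc ▸ hg) hc'
    · obtain ⟨g, hg, hgc⟩ := Finset.mem_image.1 (hσ'dom c' hc')
      rw [← h, hσ'nG c hc] at hgc; exact absurd (p.1.injective hgc ▸ hg) hc
    · rw [hσ'nG c hc, hσ'nG c' hc'] at h
      exact p.1.injective h
  let π : Equiv.Perm (Fin m) := Equiv.ofBijective σ' (Finite.injective_iff_bijective.1 hinj)
  have hYeq : Y = G.image fun g => (σ' g, g) := by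
    ext e
    constructor
    · intro he
      have hc : e.2 ∈ G := hrng ▸ mem_rng.2 ⟨e.1, he⟩
      have : e = (σ' e.2, e.2) := hY _ he _ (hσ'G e.2 hc) (Or.inr rfl)
      exact Finset.mem_image.2 ⟨e.2, hc, this.symm⟩
    · intro he; obtain ⟨g, hg, rfl⟩ := Finset.mem_image.1 he; exact hσ'G g hg
  have hwY : ∑ e ∈ Y, v e.1 e.2 l₀ = ∑ g ∈ G, v (σ' g) g l₀ := by
    rw [hYeq]; exact wt_gad π G (fun a c => v a c l₀)
  refine ⟨(π, p.2), ?_, rfl, ?_⟩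
  · rw [termSign_ne_zero_iff]
    intro c
    by_cases hc : c ∈ G
    · show ε (σ' c) c (p.2 c) ≠ 0
      rw [hcls c hc]; exact hpres _ (hσ'G c hc)
    · show ε (σ' c) c (p.2 c) ≠ 0
      rw [hσ'nG c hc]; exact (termSign_ne_zero_iff ε p).1 hp c
  · have hsplit : ∀ f : Fin m → ℤ, ∑ i, f i = (∑ i ∈ G, f i) + ∑ i ∈ Gᶜ, f i :=
      fun f => (Finset.sum_add_sum_compl G f).symm
    have hVp : ∑ i, v (p.1 i) i (p.2 i) = (∑ g ∈ G, v (p.1 g) g l₀) + ∑ i ∈ Gᶜ, v (p.1 i) i (p.2 i) := by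
      rw [hsplit]; congr 1
      exact Finset.sum_congr rfl fun g hg => by rw [hcls g hg]
    have hVq : ∑ i, v (π i) i (p.2 i) = (∑ e ∈ Y, v e.1 e.2 l₀) + ∑ i ∈ Gᶜ, v (p.1 i) i (p.2 i) := by
      rw [hsplit, hwY]; congr 1
      · exact Finset.sum_congr rfl fun g hg => by rw [hcls g hg]; rfl
      · exact Finset.sum_congr rfl fun i hi => by
          rw [Finset.mem_compl] at hi
          show v (σ' i) i (p.2 i) = _
          rw [hσ'nG i hi]
    show (∑ i, v (π i) i (p.2 i)) + ∑ g ∈ G, v (p.1 g) g l₀ = (∑ i, v (p.1 i) i (p.2 i)) + ∑ e ∈ Y, v e.1 e.2 l₀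
    rw [hVp, hVq]; ring

/-- **THE FIVE-POINT REGISTER-PAIR LAW.**  See the module docstring.
[folklore: valuated-matroid exchange (Murota 2003 §9) + hull convexity; the packaging is the cell's] -/
theorem registerPair_five (d : Fin K → ℕ) (v ε : Fin m → Fin m → Fin K → ℤ)
    (G N : Finset (Fin m)) (l₀ : Fin K) (rI rJ : Fin 3 → Fin m)
    (u : Fin 3 → Fin 3 → Equiv.Perm (Fin m) × (Fin m → Fin K))
    {θ02 θ10 θ11 θ20 θ21 : ℤ}
    (hd02 : IsDominant d v ε θ02 (u 0 2)) (hd10 : IsDominant d v ε θ10 (u 1 0)) (hd11 : IsDominant d v ε θ11 (u 1 1))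
    (hd20 : IsDominant d v ε θ20 (u 2 0)) (hd21 : IsDominant d v ε θ21 (u 2 1))
    (hpres : ∀ a b, termSign ε (u a b) ≠ 0)
    (hSI : ∀ a a' b, a < a' → slope d (u a b) < slope d (u a' b))
    (hSJ : ∀ a b b', b < b' → slope d (u a b) < slope d (u a b'))
    (hcls : ∀ a b, ∀ g ∈ G, (u a b).2 g = l₀)
    (himg : ∀ a b, G.image (u a b).1 = insert (rI a) (insert (rJ b) N))
    (hIN : ∀ a, rI a ∉ N) (hJN : ∀ b, rJ b ∉ N) (hIJ : ∀ a b, rI a ≠ rJ b)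
    (hI : Function.Injective rI) (hJ : Function.Injective rJ)
    (hout : ∀ c, c ∉ G →
      (∀ a b b', ((u a b).1 c, (u a b).2 c) = ((u a b').1 c, (u a b').2 c)) ∨
      (∀ a a' b, ((u a b).1 c, (u a b).2 c) = ((u a' b).1 c, (u a' b).2 c))) :
    False := by
  classical
  have hpresu : ∀ a b c, ε ((u a b).1 c) c ((u a b).2 c) ≠ 0 := fun a b => (termSign_ne_zero_iff ε _).1 (hpres a b)
  have hpresG : ∀ a b, ∀ e ∈ G.image (fun g => ((u a b).1 g, g)), ε e.1 e.2 l₀ ≠ 0 := by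
    intro a b e he
    obtain ⟨g, hg, rfl⟩ := Finset.mem_image.1 he
    have := hpresu a b g
    rwa [hcls a b g hg] at this
  -- gadget values and the split of the columnwise sums
  set VG : Fin 3 → Fin 3 → ℤ := fun a b => ∑ g ∈ G, v ((u a b).1 g) g l₀ with hVGdef
  have hsplit : ∀ f : Fin m → ℤ, ∑ i, f i = (∑ i ∈ G, f i) + ∑ i ∈ Gᶜ, f i :=
    fun f => (Finset.sum_add_sum_compl G f).symm
  -- modularity off the gadget: slopes
  have hSmod : ∀ a a' b b', slope d (u a b) + slope d (u a' b') = slope d (u a b') + slope d (u a' b) := by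
    intro a a' b b'
    unfold TropicalCensus.slope
    rw [← Finset.sum_add_distrib, ← Finset.sum_add_distrib]
    refine Finset.sum_congr rfl fun c _ => ?_
    by_cases hc : c ∈ G
    · rw [hcls a b c hc, hcls a' b' c hc, hcls a b' c hc, hcls a' b c hc]
    · rcases hout c hc with h | h
      · have e1 := congrArg (fun q : Fin m × Fin K => (d q.2 : ℤ)) (h a b b')
        have e2 := congrArg (fun q : Fin m × Fin K => (d q.2 : ℤ)) (h a' b b')
        simp only at e1 e2
        linarith
      · have e1 := congrArg (fun q : Fin m × Fin K => (d q.2 : ℤ)) (h a a' b)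
        have e2 := congrArg (fun q : Fin m × Fin K => (d q.2 : ℤ)) (h a a' b')
        simp only at e1 e2
        linarith
  -- modularity off the gadget: valuations, up to the gadget values
  have hVmod : ∀ a a' b b',
      (∑ i, v ((u a b).1 i) i ((u a b).2 i)) + (∑ i, v ((u a' b').1 i) i ((u a' b').2 i)) - VG a b - VG a' b' =
      (∑ i, v ((u a b').1 i) i ((u a b').2 i)) + (∑ i, v ((u a' b).1 i) i ((u a' b).2 i)) - VG a b' - VG a' b := by
    intro a a' b b'
    have hG : ∀ x y, ∑ i ∈ G, v ((u x y).1 i) i ((u x y).2 i) = VG x y := fun x y =>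
      Finset.sum_congr rfl fun g hg => by rw [hcls x y g hg]
    rw [hsplit (fun i => v ((u a b).1 i) i ((u a b).2 i)), hsplit (fun i => v ((u a' b').1 i) i ((u a' b').2 i)),
      hsplit (fun i => v ((u a b').1 i) i ((u a b').2 i)), hsplit (fun i => v ((u a' b).1 i) i ((u a' b).2 i)),
      hG, hG, hG, hG]
    have hC : (∑ i ∈ Gᶜ, v ((u a b).1 i) i ((u a b).2 i)) + ∑ i ∈ Gᶜ, v ((u a' b').1 i) i ((u a' b').2 i) =
        (∑ i ∈ Gᶜ, v ((u a b').1 i) i ((u a b').2 i)) + ∑ i ∈ Gᶜ, v ((u a' b).1 i) i ((u a' b).2 i) := by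
      rw [← Finset.sum_add_distrib, ← Finset.sum_add_distrib]
      refine Finset.sum_congr rfl fun c hc => ?_
      rw [Finset.mem_compl] at hc
      rcases hout c hc with h | h
      · have e1 := congrArg (fun q : Fin m × Fin K => v q.1 c q.2) (h a b b')
        have e2 := congrArg (fun q : Fin m × Fin K => v q.1 c q.2) (h a' b b')
        simp only at e1 e2
        linarith
      · have e1 := congrArg (fun q : Fin m × Fin K => v q.1 c q.2) (h a a' b)
        have e2 := congrArg (fun q : Fin m × Fin K => v q.1 c q.2) (h a a' b')
        simp only at e1 e2
        linarith
    linarith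
  -- the gadget parts as matchings
  have hM : ∀ a b, IsPMatching (G.image fun g => ((u a b).1 g, g)) := fun a b => isPMatching_gad _ _
  have hMdom : ∀ a b, dom (G.image fun g => ((u a b).1 g, g)) = insert (rI a) (insert (rJ b) N) := fun a b => by
    rw [dom_gad, himg]
  have hMwt : ∀ a b, ∑ e ∈ G.image (fun g => ((u a b).1 g, g)), v e.1 e.2 l₀ = VG a b := fun a b =>
    wt_gad _ _ (fun x c => v x c l₀)
  -- (L1) strict supermodularity against ANY gadget matchings over the outer states, when the inner states are dominant
  have L1 : ∀ a a' b b', a < a' → b < b' → ∀ {θB θC : ℤ}, IsDominant d v ε θB (u a b') → IsDominant d v ε θC (u a' b) →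
      ∀ M M' : Finset (Fin m × Fin m), IsPMatching M → rng M = G → dom M = insert (rI a) (insert (rJ b) N) →
      (∀ e ∈ M, ε e.1 e.2 l₀ ≠ 0) → IsPMatching M' → rng M' = G → dom M' = insert (rI a') (insert (rJ b') N) →
      (∀ e ∈ M', ε e.1 e.2 l₀ ≠ 0) →
      VG a b' + VG a' b < (∑ e ∈ M, v e.1 e.2 l₀) + ∑ e ∈ M', v e.1 e.2 l₀ := by
    intro a a' b b' ha hb θB θC hB hC M M' hMm hrM hdM hpM hM'm hrM' hdM' hpM'
    obtain ⟨qA, hqA, hsA, hvA⟩ := hybrid d v ε (hpres a b) G l₀ (hcls a b) hMm hrM (by rw [himg]; exact hdM) hpM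
    obtain ⟨qD, hqD, hsD, hvD⟩ := hybrid d v ε (hpres a' b') G l₀ (hcls a' b') hM'm hrM' (by rw [himg]; exact hdM') hpM'
    have hpar := parallelogram d v ε hB hC hqA hqD (by rw [hsA, hsD]; exact hSmod a a' b b')
      (by rw [hsA]; exact hSJ a b b' hb) (by rw [hsA]; exact hSI a a' b ha)
    have := hVmod a a' b b'
    linarith
  -- gadget minimality for the dominant states
  have hmin : ∀ a b {θ0 : ℤ}, IsDominant d v ε θ0 (u a b) → ∀ (Y : Finset (Fin m × Fin m)), IsPMatching Y → rng Y = G →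
      dom Y = insert (rI a) (insert (rJ b) N) → (∀ e ∈ Y, ε e.1 e.2 l₀ ≠ 0) → VG a b ≤ ∑ e ∈ Y, v e.1 e.2 l₀ :=
    fun a b θ0 hd Y hY hr hdY hp => gadget_min d v ε hd G l₀ (hcls a b) hY hr ((himg a b).symm ▸ hdY) hp
  -- (L3 = beta) any two phantoms weigh at least `VG a b' + VG a' b` (inner states dominant)
  have L3 : ∀ a a' b b', a < a' → b < b' → ∀ {θB θC : ℤ}, IsDominant d v ε θB (u a b') → IsDominant d v ε θC (u a' b) →
      ∀ X Y : Finset (Fin m × Fin m), IsPMatching X → IsPMatching Y →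
      rng X = G → rng Y = G → dom X = insert (rJ b) (insert (rJ b') N) → dom Y = insert (rI a) (insert (rI a') N) →
      (∀ e ∈ X, ε e.1 e.2 l₀ ≠ 0) → (∀ e ∈ Y, ε e.1 e.2 l₀ ≠ 0) →
      VG a b' + VG a' b ≤ (∑ e ∈ X, v e.1 e.2 l₀) + ∑ e ∈ Y, v e.1 e.2 l₀ := by
    intro a a' b b' ha hb θB θC hB hC X Y hX hY hrX hrY hdX hdY hpX hpY
    have haa : rI a ≠ rI a' := fun h => (ne_of_lt ha) (hI h)
    have hbb : rJ b ≠ rJ b' := fun h => (ne_of_lt hb) (hJ h)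
    have hcard : Y.card = X.card := by rw [← hY.card_rng, ← hX.card_rng, hrY, hrX]
    have hx : rI a ∈ dom Y := by rw [hdY]; simp
    have hx' : rI a ∉ dom X := by
      rw [hdX]; simp only [Finset.mem_insert, not_or]; exact ⟨hIJ a b, hIJ a b', hIN a⟩
    obtain ⟨z, hz, hz', X'', Y'', hX'', hY'', hU, hInt, hrX'', hrY'', hdX'', hdY''⟩ :=
      basis_exchange hY hX hcard (hrY.trans hrX.symm) hx hx'
    have hwt := wt_add_eq hU hInt (fun e => v e.1 e.2 l₀)
    have hpres'' : ∀ e ∈ X'' ∪ Y'', ε e.1 e.2 l₀ ≠ 0 := by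
      rw [hU]; intro e he
      rcases Finset.mem_union.1 he with he | he
      · exact hpY e he
      · exact hpX e he
    have hpX'' : ∀ e ∈ X'', ε e.1 e.2 l₀ ≠ 0 := fun e he => hpres'' e (Finset.mem_union_left _ he)
    have hpY'' : ∀ e ∈ Y'', ε e.1 e.2 l₀ ≠ 0 := fun e he => hpres'' e (Finset.mem_union_right _ he)
    rw [hdY] at hdX''
    rw [hdX, Finset.mem_insert, Finset.mem_insert] at hz
    have hzN : z ∉ N := fun h => hz' (hdY ▸ Finset.mem_insert_of_mem (Finset.mem_insert_of_mem h))
    have hdX''' : dom X'' = insert z (insert (rI a') N) := by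
      rw [hdX'', Finset.erase_insert]
      simp only [Finset.mem_insert, not_or]; exact ⟨haa, hIN a⟩
    rcases hz with hz | hz | hz
    · subst hz
      have h1 : VG a' b ≤ ∑ e ∈ X'', v e.1 e.2 l₀ :=
        hmin a' b hC X'' hX'' (hrX''.trans hrY) (by rw [hdX''', Finset.insert_comm]) hpX''
      have h2 : VG a b' ≤ ∑ e ∈ Y'', v e.1 e.2 l₀ :=
        hmin a b' hB Y'' hY'' (hrY''.trans hrY) (by rw [hdY'', hdX, Finset.erase_insert]; simp [hbb, hJN b]) hpY''
      linarith
    · subst hz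
      have h1 := L1 a a' b b' ha hb hB hC Y'' X'' hY'' (hrY''.trans hrY)
        (by rw [hdY'', hdX, erase_insert_insert hbb (hJN b')]) hpY'' hX'' (hrX''.trans hrY)
        (by rw [hdX''', Finset.insert_comm]) hpX''
      linarith
    · exact absurd hz hzN
  -- (L2 = alpha) the phantoms exist, with total weight `VG a b' + VG a' b` (inner states dominant)
  have L2 : ∀ a a' b b', a < a' → b < b' → ∀ {θB θC : ℤ}, IsDominant d v ε θB (u a b') → IsDominant d v ε θC (u a' b) →
      ∃ X Y : Finset (Fin m × Fin m), IsPMatching X ∧ IsPMatching Y ∧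
      rng X = G ∧ rng Y = G ∧ dom X = insert (rJ b) (insert (rJ b') N) ∧ dom Y = insert (rI a) (insert (rI a') N) ∧
      (∀ e ∈ X, ε e.1 e.2 l₀ ≠ 0) ∧ (∀ e ∈ Y, ε e.1 e.2 l₀ ≠ 0) ∧
      (∑ e ∈ X, v e.1 e.2 l₀) + ∑ e ∈ Y, v e.1 e.2 l₀ = VG a b' + VG a' b := by
    intro a a' b b' ha hb θB θC hB hC
    have haa : rI a ≠ rI a' := fun h => (ne_of_lt ha) (hI h)
    have hbb : rJ b ≠ rJ b' := fun h => (ne_of_lt hb) (hJ h)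
    set M := G.image fun g => ((u a b').1 g, g) with hMdef
    set M' := G.image fun g => ((u a' b).1 g, g) with hM'def
    have hcard : M.card = M'.card := by rw [card_gad, card_gad]
    have hx : rI a ∈ dom M := by rw [hMdom]; simp
    have hx' : rI a ∉ dom M' := by
      rw [hMdom]; simp only [Finset.mem_insert, not_or]; exact ⟨haa, hIJ a b, hIN a⟩
    obtain ⟨z, hz, hz', X, Y, hX, hY, hU, hInt, hrX, hrY, hdX, hdY⟩ :=
      basis_exchange (hM a b') (hM a' b) hcard (by rw [rng_gad, rng_gad]) hx hx'
    have hwt := wt_add_eq hU hInt (fun e => v e.1 e.2 l₀)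
    rw [hMwt, hMwt] at hwt
    have hpres'' : ∀ e ∈ X ∪ Y, ε e.1 e.2 l₀ ≠ 0 := by
      rw [hU]; intro e he
      rcases Finset.mem_union.1 he with he | he
      · exact hpresG a b' e he
      · exact hpresG a' b e he
    have hpX : ∀ e ∈ X, ε e.1 e.2 l₀ ≠ 0 := fun e he => hpres'' e (Finset.mem_union_left _ he)
    have hpY : ∀ e ∈ Y, ε e.1 e.2 l₀ ≠ 0 := fun e he => hpres'' e (Finset.mem_union_right _ he)
    have hrGX : rng X = G := by rw [hrX]; exact rng_gad _ _
    have hrGY : rng Y = G := by rw [hrY]; exact rng_gad _ _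
    rw [hMdom] at hdX hdY hz
    rw [hMdom] at hz'
    rw [Finset.mem_insert, Finset.mem_insert] at hz
    have hzN : z ∉ N := fun h => hz' (Finset.mem_insert_of_mem (Finset.mem_insert_of_mem h))
    have hdX' : dom X = insert z (insert (rJ b') N) := by
      rw [hdX, Finset.erase_insert]
      simp only [Finset.mem_insert, not_or]; exact ⟨hIJ a b', hIN a⟩
    rcases hz with hz | hz | hz
    · subst hz
      have h1 := L1 a a' b b' ha hb hB hC Y X hY hrGY
        (by rw [hdY, Finset.erase_insert]; simp [hIJ a' b, hIN a']) hpY hX hrGX hdX' hpX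
      exfalso; linarith
    · subst hz
      refine ⟨X, Y, hX, hY, hrGX, hrGY, ?_, ?_, hpX, hpY, by linarith⟩
      · rw [hdX', Finset.insert_comm]
      · rw [hdY, erase_insert_insert (hIJ a' b) (hJN b), Finset.insert_comm]
    · exact absurd hz hzN
  -- (L4) the four minors and the final one
  have h01 : (0 : Fin 3) < 1 := by decide
  have h02 : (0 : Fin 3) < 2 := by decide
  have h12 : (1 : Fin 3) < 2 := by decide
  obtain ⟨X1, Y1, hX1, hY1, rX1, rY1, dX1, dY1, pX1, pY1, w1⟩ := L2 0 1 0 2 h01 h02 hd02 hd10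
  obtain ⟨X2, Y2, hX2, hY2, rX2, rY2, dX2, dY2, pX2, pY2, w2⟩ := L2 0 1 1 2 h01 h12 hd02 hd11
  obtain ⟨X3, Y3, hX3, hY3, rX3, rY3, dX3, dY3, pX3, pY3, w3⟩ := L2 0 2 0 2 h02 h02 hd02 hd20
  obtain ⟨X4, Y4, hX4, hY4, rX4, rY4, dX4, dY4, pX4, pY4, w4⟩ := L2 0 2 1 2 h02 h12 hd02 hd21
  have b12 := L3 0 1 0 2 h01 h02 hd02 hd10 X1 Y2 hX1 hY2 rX1 rY2 dX1 dY2 pX1 pY2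
  have b21 := L3 0 1 1 2 h01 h12 hd02 hd11 X2 Y1 hX2 hY1 rX2 rY1 dX2 dY1 pX2 pY1
  have b34 := L3 0 2 0 2 h02 h02 hd02 hd20 X3 Y4 hX3 hY4 rX3 rY4 dX3 dY4 pX3 pY4
  have b43 := L3 0 2 1 2 h02 h12 hd02 hd21 X4 Y3 hX4 hY3 rX4 rY3 dX4 dY3 pX4 pY3
  have b31 := L3 0 1 0 2 h01 h02 hd02 hd10 X3 Y1 hX3 hY1 rX3 rY1 dX3 dY1 pX3 pY1
  have b13 := L3 0 2 0 2 h02 h02 hd02 hd20 X1 Y3 hX1 hY3 rX1 rY3 dX1 dY3 pX1 pY3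
  have b42 := L3 0 1 1 2 h01 h12 hd02 hd11 X4 Y2 hX4 hY2 rX4 rY2 dX4 dY2 pX4 pY2
  have b24 := L3 0 2 1 2 h02 h12 hd02 hd21 X2 Y4 hX2 hY4 rX2 rY4 dX2 dY4 pX2 pY4
  have key := L1 1 2 0 1 h12 h01 hd11 hd20 _ _ (hM 1 0) (rng_gad _ _) (hMdom 1 0) (hpresG 1 0)
    (hM 2 1) (rng_gad _ _) (hMdom 2 1) (hpresG 2 1)
  rw [hMwt, hMwt] at key
  linarith

end RegisterPair

end Summit.ValiantsHypothesis.ValiantsHypothesis.Theorems.KPlusLogSqLaw
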